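import Summits.QuantumFields.BalabanUV.T4Continuum.Spine.NE5.ProductWalks

/-!
# Spine/NE5/NeumannChainWalks — CHAINS of walk terms (the Neumann family of the covariance step T9) at the ENTRY level:
# per-term bound at ONE chain rate with the concatenated walk distance, and UNIFORM partial-sum majorants of the whole
# (chain, seed) family with the constant `A(1 − q)⁻¹` (cell `pub-balaban-gaps`, seat `ne5` gen 5; second building block of T9)

WHY.  Along row NE5's precision pencil `A_t = A + tP` the covariance is `(A_t)⁻¹ = Σₙ (−t)ⁿ (A⁻¹P)ⁿA⁻¹` — a family of
CHAINS: steps = the walk terms of the product family `(−tP)·A⁻¹` (`Spine/NE5/ProductWalks.walkMajorants_mul`, the left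
factor paying), seed = the walk terms of `A⁻¹`.  This file transports the tree's [B9] Sect. D chain bookkeeping
(`B9SectDWalk.chainConst`, `chainDist`, `chainMaj`, `neumann_majSumLe` — stated there for linear maps with block norms)
to the matrix-ENTRY currency of `B13JointWalkExpansion`:
* §1 `norm_chain_entry_le` — steps `‖S_i a b‖ ≤ θ_i e^{−δD_i(loc a, loc b)}` (`D_i ≥ d₁`), seed `‖T₀ a b‖ ≤ A e^{−ρD₀}`, fibre
  multiplicity `m`, row sum (2.61) at rate `σ`, `ρ + σ ≤ δ` ⟹ every chain `S_{i₁}⋯S_{iₙ}T₀` is bounded entrywise by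
  `chainConst m c θ A l · e^{−ρ·chainDist D D₀ l}` — the SAME rate `ρ` on the concatenated distance, every step paying its
  own boundary from its excess `δ − ρ ≥ σ` ([B9] p. 410 *"the exponentials with ½δ₀ instead of δ₀"*);
* §2 `chain_majorant_le_chainMaj` — the exponential chain majorant at rate `ρ` is dominated by the ITERATED majorant
  `chainMaj (mc) mK mS l` of the step ∕ seed majorant families taken at any rates `≤ ρ` (so the drop windows of
  `ProductWalks` compose along the chain);
* §3 `majSumLe_chain` — hence, by `B9SectDWalk.neumann_majSumLe` (multilinearity + the geometric series, NO walk counting),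
  the partial sums of the exponential majorants over EVERY finite set of (chain, seed) pairs are bounded by
  `A(1 − q)⁻¹e^{−κd}` with `q = (mc)·θ̄·c_row < 1` — the MARGIN SMALLNESS of T9 (`θ̄ ∝ s·K̄_E·K̄_C`: [II] p. 13, p. 17).
WHAT T9 STILL NEEDS after this file: the `HasSum` identification of the chain family with `(A + tP)⁻¹` entrywise (finite
torus: telescoping `A_t·Σₙ(−t)ⁿ(A⁻¹P)ⁿA⁻¹ = 1` with the remainder killed by `q^N → 0`) and, from the BUILDER, a rate-drop
window for both precision and covariance (typing point (x5) of `ne/NE5.md` §11).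

HONEST FRAMING.  Bookkeeping over landed hypothesis SHAPES and the tree's [B9] Sect. D walk algebra; the step ∕ seed families
and every constant are HYPOTHESES; nothing of Bałaban's is constructed or asserted; NE5 NOT PRINTED ∕ NOT PROVED; (D4) NOT
discharged; spine PROVED 0∕9; rung (B)+1 on a FIXED finite T⁴ — NOT continuum, NOT infinite volume, NOT mass gap, NOT Clay.
HONEST DEPENDENCY: continuum YM on T⁴ ⇐ BetaPertH ∧ nine spine estimates; BetaPertH ⇐ (D1) ∧ (D4) ∧ CAP+tail.  0 sorry, 0 def.

Sources: [B9] = T. Bałaban, CMP **99** (1985) [Balaban1985BackgroundPropagators] (3.92)–(3.94) p. 410, (3.107)–(3.108) p. 416,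
(3.130) p. 421, p. 422; [B6] = CMP **96** (1984) [Balaban1984PropagatorsII] (2.54) p. 233, (2.61) p. 234; [II] = CMP **116**
(1988) [Balaban1988RG2Cluster] p. 13, p. 17.  Nothing here is a claim about the Yang–Mills mass gap.
-/

noncomputable section

namespace Summit.QuantumFields.BalabanUV.T4Continuum.Spine.NE5.NeumannChainWalks

open Metric Set Finset
open Literature.MathematicalPhysics.QuantumFieldTheory.Balaban1983to89
open Literature.MathematicalPhysics.QuantumFieldTheory.Balaban1983to89.B9SectDWalk
  (Through MajSumLe DomBy infConv conv chainConst chainDist chainMaj)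
open Literature.MathematicalPhysics.QuantumFieldTheory.Balaban1983to89.B9Thm34Ext (toB6)
open Literature.MathematicalPhysics.QuantumFieldTheory.Balaban1983to89.B9Thm37GlueTorus
  (torusGeom tdist1 tdist1_nonneg hdnn_torusGeom htri_torusGeom)
open Literature.MathematicalPhysics.QuantumFieldTheory.Balaban1983to89.B5TorusCover (UT)
open Literature.MathematicalPhysics.QuantumFieldTheory.Balaban1983to89.B11SectG (RowSum)
open Summit.QuantumFields.BalabanUV.T4Continuum.Spine.NE5.ProductWalks
  (sum_loc_le_mul_sum norm_mul_entry_le_of_walks exp_infConv_le_sum)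

variable {ν : ℕ} {Nf : Fin ν → ℕ} [∀ i, NeZero (Nf i)]
variable {ι n q : Type} [Fintype n]

/-! ## §1. Per-term bound of a chain of step matrices over a seed -/

/-- The chain distance is non-negative when the step and seed distances dominate `d₁ ≥ 0`. [folklore] -/
theorem chainDist_nonneg {D : ι → UT Nf → UT Nf → ℝ} {DS : UT Nf → UT Nf → ℝ}
    (hD : ∀ i, DomBy (toB6 (torusGeom Nf 0 0 0) 0 True) (D i)) (hDS : DomBy (toB6 (torusGeom Nf 0 0 0) 0 True) DS)
    (l : List ι) (a b : UT Nf) : 0 ≤ chainDist (g := toB6 (torusGeom Nf 0 0 0) 0 True) D DS l a b :=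
  (hdnn_torusGeom 0 0 0 a b).trans (B9SectDWalk.domBy_chainDist (htri_torusGeom 0 0 0 0 True) hD hDS l a b)

/-- **PER-TERM BOUND OF A CHAIN** ((3.108) shape for a walk of walk terms, entry level): steps `S_i` with
`‖S_i a b‖ ≤ θ_i e^{−δD_i(loc a, loc b)}`, `D_i ≥ d₁`; seed `T₀` with `‖T₀ a b‖ ≤ A e^{−ρD₀(loc a, loc′ b)}`, `D₀ ≥ d₁`; fibre
multiplicity `m` of the step locator; row sum at rate `σ` with constant `c`; `ρ + σ ≤ δ`.  Then the chain `S_{i₁}⋯S_{iₙ}·T₀` is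
bounded entrywise by `chainConst m c θ A l · e^{−ρ·chainDist D D₀ l(loc a, loc′ b)}`: every step pays its own boundary row sum
from its excess rate, the chain keeps the rate `ρ`. [cite: Balaban1985BackgroundPropagators, (3.107)–(3.108) p.416, (3.92)–(3.94) p.410, p.422] -/
theorem norm_chain_entry_le (locn : n → UT Nf) (locq : q → UT Nf) {m : ℕ}
    (hfib : ∀ y : UT Nf, (Finset.univ.filter fun k => locn k = y).card ≤ m)
    {S : ι → Matrix n n ℂ} {T₀ : Matrix n q ℂ} {θ : ι → ℝ} {D : ι → UT Nf → UT Nf → ℝ} {A δ ρ σ c : ℝ}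
    {D₀ : UT Nf → UT Nf → ℝ}
    (hθ : ∀ i, 0 ≤ θ i) (hA : 0 ≤ A) (hρ : 0 ≤ ρ) (hσ : 0 ≤ σ) (hρδ : ρ + σ ≤ δ)
    (hD : ∀ i, DomBy (toB6 (torusGeom Nf 0 0 0) 0 True) (D i)) (hD₀ : DomBy (toB6 (torusGeom Nf 0 0 0) 0 True) D₀)
    (hrow : RowSum (toB6 (torusGeom Nf 0 0 0) 0 True) σ c)
    (hS : ∀ i a b, ‖S i a b‖ ≤ θ i * Real.exp (-(δ * D i (locn a) (locn b))))
    (hT : ∀ a b, ‖T₀ a b‖ ≤ A * Real.exp (-(ρ * D₀ (locn a) (locq b)))) :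
    ∀ (l : List ι) (a : n) (b : q), ‖(l.foldr (fun i M => S i * M) T₀) a b‖ ≤
      chainConst (m : ℝ) c θ A l * Real.exp (-(ρ * chainDist (g := toB6 (torusGeom Nf 0 0 0) 0 True) D D₀ l (locn a) (locq b))) := by
  intro l
  induction l with
  | nil =>
      intro a b
      simpa [chainConst, chainDist] using hT a b
  | cons i l ih =>
      intro a b
      have hc : 0 ≤ c := by
        rcases isEmpty_or_nonempty (UT Nf) with h | ⟨⟨y⟩⟩
        · exact (h.false (locn a)).elim
        · exact B11SectG.RowSum.nonneg hrow y
      have hconst : 0 ≤ chainConst (m : ℝ) c θ A l :=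
        B9SectDWalk.chainConst_nonneg (Nat.cast_nonneg m) hc hθ hA l
      have h := norm_mul_entry_le_of_walks (Nf := Nf) locn locn locq hfib (hθ i) hconst hρ le_rfl hσ hρδ (hD i)
        (chainDist_nonneg hD hD₀ l) hrow (fun a k => hS i a k) (fun k b => ih k b) a b
      simp only [List.foldr_cons, B9SectDWalk.chainConst_cons, B9SectDWalk.chainDist_cons]
      calc ‖(S i * List.foldr (fun i M => S i * M) T₀ l) a b‖
          ≤ (m * c * (θ i * chainConst (m : ℝ) c θ A l)) *
              Real.exp (-(ρ * infConv (g := toB6 (torusGeom Nf 0 0 0) 0 True) (D i)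
                (chainDist (g := toB6 (torusGeom Nf 0 0 0) 0 True) D D₀ l) (locn a) (locq b))) := h
        _ = (m * θ i * chainConst (m : ℝ) c θ A l * c) *
              Real.exp (-(ρ * infConv (g := toB6 (torusGeom Nf 0 0 0) 0 True) (D i)
                (chainDist (g := toB6 (torusGeom Nf 0 0 0) 0 True) D D₀ l) (locn a) (locq b))) := by ring

/-! ## §2. The exponential chain majorant is dominated by the iterated majorant of the step ∕ seed families -/

/-- **Domination by the iterated majorant**: with step majorants `mK i = θ_i e^{−rD_i}` and seed majorant `mS = A e^{−r₀D₀}`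
taken at rates `r, r₀ ≤ ρ` (the DROP windows of the factors), the exponential chain majorant at the chain rate `ρ` satisfies
`chainConst m c θ A l · e^{−ρ·chainDist(a,b)} ≤ chainMaj (mc) mK mS l (a,b)` (one term of each convolution sum: the attained
infimum of (3.93)). [cite: Balaban1985BackgroundPropagators, (3.93) p.410, p.422] -/
theorem chain_majorant_le_chainMaj {m : ℕ} {θ : ι → ℝ} {D : ι → UT Nf → UT Nf → ℝ} {A ρ r r₀ c : ℝ}
    {D₀ : UT Nf → UT Nf → ℝ} (hθ : ∀ i, 0 ≤ θ i) (hA : 0 ≤ A) (hc : 0 ≤ c) (hr : r ≤ ρ) (hr₀ : r₀ ≤ ρ)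
    (hD : ∀ i, DomBy (toB6 (torusGeom Nf 0 0 0) 0 True) (D i)) (hD₀ : DomBy (toB6 (torusGeom Nf 0 0 0) 0 True) D₀) :
    ∀ (l : List ι) (a b : UT Nf),
      chainConst (m : ℝ) c θ A l * Real.exp (-(ρ * chainDist (g := toB6 (torusGeom Nf 0 0 0) 0 True) D D₀ l a b)) ≤
        chainMaj (g := toB6 (torusGeom Nf 0 0 0) 0 True) (m * c) (fun i a b => θ i * Real.exp (-(r * D i a b)))
          (fun a b => A * Real.exp (-(r₀ * D₀ a b))) l a b := by
  have hDnn : ∀ i a b, 0 ≤ D i a b := fun i a b => (hdnn_torusGeom 0 0 0 a b).trans (hD i a b)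
  have hD₀nn : ∀ a b, 0 ≤ D₀ a b := fun a b => (hdnn_torusGeom 0 0 0 a b).trans (hD₀ a b)
  intro l
  induction l with
  | nil =>
      intro a b
      simp only [B9SectDWalk.chainConst_nil, B9SectDWalk.chainDist_nil, B9SectDWalk.chainMaj_nil]
      exact mul_le_mul_of_nonneg_left (Real.exp_le_exp.2 (neg_le_neg (mul_le_mul_of_nonneg_right hr₀ (hD₀nn a b)))) hA
  | cons i l ih =>
      intro a b
      simp only [B9SectDWalk.chainConst_cons, B9SectDWalk.chainDist_cons, B9SectDWalk.chainMaj_cons, conv]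
      have hCl : 0 ≤ chainConst (m : ℝ) c θ A l := B9SectDWalk.chainConst_nonneg (Nat.cast_nonneg m) hc hθ hA l
      have hsum := exp_infConv_le_sum (Nf := Nf) (D₁ := D i)
        (D₂ := chainDist (g := toB6 (torusGeom Nf 0 0 0) 0 True) D D₀ l) hr le_rfl (hDnn i)
        (chainDist_nonneg hD hD₀ l) a b
      calc (m : ℝ) * θ i * chainConst (m : ℝ) c θ A l * c *
            Real.exp (-(ρ * infConv (g := toB6 (torusGeom Nf 0 0 0) 0 True) (D i)
              (chainDist (g := toB6 (torusGeom Nf 0 0 0) 0 True) D D₀ l) a b))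
          ≤ (m : ℝ) * θ i * chainConst (m : ℝ) c θ A l * c *
            ∑ y : UT Nf, Real.exp (-(r * D i a y)) *
              Real.exp (-(ρ * chainDist (g := toB6 (torusGeom Nf 0 0 0) 0 True) D D₀ l y b)) :=
            mul_le_mul_of_nonneg_left hsum (mul_nonneg (mul_nonneg (mul_nonneg (Nat.cast_nonneg m) (hθ i)) hCl) hc)
        _ = ∑ y : UT Nf, (θ i * Real.exp (-(r * D i a y))) * ((m * c) *
              (chainConst (m : ℝ) c θ A l * Real.exp (-(ρ * chainDist (g := toB6 (torusGeom Nf 0 0 0) 0 True) D D₀ l y b)))) := by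
            rw [Finset.mul_sum]; exact Finset.sum_congr rfl fun y _ => by ring
        _ ≤ ∑ y : UT Nf, (θ i * Real.exp (-(r * D i a y))) * ((m * c) *
              chainMaj (g := toB6 (torusGeom Nf 0 0 0) 0 True) (m * c) (fun i a b => θ i * Real.exp (-(r * D i a b)))
                (fun a b => A * Real.exp (-(r₀ * D₀ a b))) l y b) :=
            Finset.sum_le_sum fun y _ => mul_le_mul_of_nonneg_left
              (mul_le_mul_of_nonneg_left (ih y b) (mul_nonneg (Nat.cast_nonneg m) hc)) (mul_nonneg (hθ i) (Real.exp_nonneg _))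

/-! ## §3. Uniform partial-sum majorants of the whole (chain, seed) family -/

/-- **SUMMABILITY OF THE NEUMANN FAMILY WITH THE CONSTANT `A(1 − q)⁻¹`** (entry level; `B9SectDWalk.neumann_majSumLe` BY NAME):
step TERM family `i ∈ ι` with majorants `θ_i e^{−rD_i}` whose partial sums are `≤ θ̄e^{−δ′d}`, seed family `ω ∈ W₀` with
majorants `A_ω e^{−r₀D₀,ω}` whose partial sums are `≤ Āe^{−ρ_S d}`, all walk distances dominating `d₁`, rates `r, r₀ ≤ ρ`, torus
rates `κ ≤ ρ_S`, `κ + σ′ ≤ δ′`, and the SMALLNESS `q := (mc)·θ̄·c′ < 1`.  Then for EVERY finite set of (chain, seed) pairs the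
exponential chain majorants at rate `ρ` sum to at most `Ā(1 − q)⁻¹·e^{−κd}` — uniformly in the chain length; no walk counting.
[cite: Balaban1985BackgroundPropagators, p.422 (after (3.131)), Thm 3.12 p.423; Balaban1984PropagatorsII, Lemma 2.1 p.234] -/
theorem majSumLe_chain {W₀ : Type} {m : ℕ} {θ : ι → ℝ} {D : ι → UT Nf → UT Nf → ℝ} {A₀ : W₀ → ℝ}
    {D₀ : W₀ → UT Nf → UT Nf → ℝ} {ρ r r₀ c θbar Abar δ' ρS κ σ' c' : ℝ}
    (hθ : ∀ i, 0 ≤ θ i) (hA₀ : ∀ ω, 0 ≤ A₀ ω) (hc : 0 ≤ c) (hr : r ≤ ρ) (hr₀ : r₀ ≤ ρ)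
    (hD : ∀ i, DomBy (toB6 (torusGeom Nf 0 0 0) 0 True) (D i))
    (hD₀ : ∀ ω, DomBy (toB6 (torusGeom Nf 0 0 0) 0 True) (D₀ ω))
    (hrow' : RowSum (toB6 (torusGeom Nf 0 0 0) 0 True) σ' c') (hσ' : 0 ≤ σ')
    (hθbar : 0 ≤ θbar) (hAbar : 0 ≤ Abar) (hκ : 0 ≤ κ) (hκS : κ ≤ ρS) (hκδ : κ + σ' ≤ δ')
    (hK : MajSumLe (g := toB6 (torusGeom Nf 0 0 0) 0 True) (fun i a b => θ i * Real.exp (-(r * D i a b)))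
      (fun a b => θbar * Real.exp (-(δ' * tdist1 Nf a b))))
    (hS : MajSumLe (g := toB6 (torusGeom Nf 0 0 0) 0 True) (fun ω a b => A₀ ω * Real.exp (-(r₀ * D₀ ω a b)))
      (fun a b => Abar * Real.exp (-(ρS * tdist1 Nf a b))))
    (hq : (m * c) * θbar * c' < 1) :
    MajSumLe (g := toB6 (torusGeom Nf 0 0 0) 0 True)
      (fun (p : List ι × W₀) a b => chainConst (m : ℝ) c θ (A₀ p.2) p.1 *
        Real.exp (-(ρ * chainDist (g := toB6 (torusGeom Nf 0 0 0) 0 True) D (D₀ p.2) p.1 a b)))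
      (fun a b => Abar * (1 - (m * c) * θbar * c')⁻¹ * Real.exp (-(κ * tdist1 Nf a b))) := by
  classical
  have hN := B9SectDWalk.neumann_majSumLe (g := toB6 (torusGeom Nf 0 0 0) 0 True) (κ := m * c)
    (mK := fun i a b => θ i * Real.exp (-(r * D i a b))) (mS := fun ω a b => A₀ ω * Real.exp (-(r₀ * D₀ ω a b)))
    (hdnn_torusGeom 0 0 0) hrow' hσ' (htri_torusGeom 0 0 0 0 True) (mul_nonneg (Nat.cast_nonneg m) hc) hθbar hAbar hκ
    hκS hκδ (fun i a b => mul_nonneg (hθ i) (Real.exp_nonneg _)) (fun ω a b => mul_nonneg (hA₀ ω) (Real.exp_nonneg _))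
    hK hS hq
  intro S a b
  refine (Finset.sum_le_sum fun p _ => ?_).trans (hN S a b)
  exact chain_majorant_le_chainMaj (hθ) (hA₀ p.2) hc hr hr₀ hD (hD₀ p.2) p.1 a b

end Summit.QuantumFields.BalabanUV.T4Continuum.Spine.NE5.NeumannChainWalks

end
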